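import Mathlib.Algebra.MvPolynomial.Basic
import Mathlib.Algebra.MvPolynomial.Eval
import Mathlib.Algebra.MvPolynomial.Rename
import Mathlib.Algebra.MvPolynomial.Degrees
import Mathlib.Algebra.Polynomial.Eval.Defs
import Mathlib.Algebra.Polynomial.Eval.Degree
import Mathlib.Data.Fintype.Card
import Mathlib.Data.Fintype.Pi
import Mathlib.Data.Fintype.Sum
import Mathlib.Data.Nat.Log
import Literature.Computability.AlgebraicComplexity.ArithCircuit
import HarnessLib

-- provenance: harness21/H21/H21/Prelude/CplxAlg/ValiantClasses.lean @ 76e3a6b (interim HEAD d8f2665); M5 mechanical rewrite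
/-!
# Valiant's complexity classes VP, VNP, VQP (trunk CplxAlg, notion `valiant_classes_VP_VNP`)

Valiant's algebraic complexity classes, as `Is…` predicates on *families* of multivariate
polynomials `f : ∀ n, MvPolynomial (σ n) k` indexed by `n : ℕ`, with finitely many variables
`σ n` at each level: p-bounded functions, p-families, p-computable families (`VP`),
p-definable families (`VNP`, via Valiant's Boolean exponential sum), quasi-polynomially computable
families (`VQP`), (p-)projections and `VNP`- and `VP`-completeness. A small bundled carrier
`PolyFamily k` turns the classes into honest sets `VP k, VNP k, VQP k : Set (PolyFamily k)` so that
"`VP ≠ VNP`" can be stated as an inequality of sets.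

## Sources

* P. Bürgisser, *Completeness and Reduction in Algebraic Complexity Theory*, Springer 2000,
  Definitions 2.1–2.9, Remark 2.6, 2.7, Definition 2.26 (`VQP`).
* L. Valiant, *Completeness classes in algebra*, STOC 1979.

## Design choices

* All side conditions are `Prop`-valued predicates (outline D2): `IsPBounded t := ∃ c, ∀ n,
  t n ≤ n ^ c + c` is Bürgisser's Def. 2.1(1) verbatim; no bound is bundled as data.
* Coefficients: every definition only needs `[CommSemiring k]` (Bürgisser works over a field; the
  target statements specialise). Variable types `σ n` carry `[∀ n, Fintype (σ n)]`; no
  `DecidableEq` is needed by any definition here, so it is not assumed.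
* Existential witness families (the `VNP` witness, the families ranged over in completeness) are
  indexed by `Fin (v n)`; this loses no generality and keeps the definitions universe-monomorphic
  in the bound variable.
* `complexity` (from `Literature.Prelude.CplxAlg.ArithCircuit`) is Bürgisser's `L_k` up to a constant
  factor, which is invisible to `IsPBounded`/`IsQPBounded`.
* Mathlib has no Valiant classes, p-projections or exponential Boolean sums (searched `Valiant`,
  `VNP`, `IsProjection` — `LinearMap.IsProj` is unrelated); only `MvPolynomial.aeval`,
  `MvPolynomial.renameEquiv`, `MvPolynomial.totalDegree`, `Fintype.equivFin`, `Polynomial.eval`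
  are reused.

Everything lives in `namespace Literature.CplxAlg`, inside a `noncomputable section`.
-/

noncomputable section

open MvPolynomial

namespace Literature.Computability.AlgebraicComplexity

universe u v w

/-! ### p-bounded and quasi-polynomially bounded functions -/

/-- A function `t : ℕ → ℕ` is *p-bounded* if `t n ≤ n ^ c + c` for some constant `c` and all `n`
(Bürgisser 2000, Def. 2.1(1)). Equivalent to being bounded by a polynomial, see
`isPBounded_iff_exists_polynomial`. [cite: Burgisser2000, Def. 2.1(1] -/
def IsPBounded (t : ℕ → ℕ) : Prop :=
  ∃ c : ℕ, ∀ n, t n ≤ n ^ c + c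

/-- A function `t : ℕ → ℕ` is *quasi-polynomially bounded* if `t n ≤ 2 ^ ((log₂ n + c) ^ c)`
for some constant `c` and all `n`. Bürgisser 2000, Def. 2.26 asks for `t n ≤ 2 ^ p (log n)` for
some polynomial `p`; the present single-constant form is equivalent (every polynomial in `log n`
is dominated by `(log n + c) ^ c` for large `c`), not verbatim. [cite: Burgisser2000, Def. 2.26 asks for  t n ≤ 2 ^ p (log n] -/
def IsQPBounded (t : ℕ → ℕ) : Prop :=
  ∃ c : ℕ, ∀ n, t n ≤ 2 ^ ((Nat.log 2 n + c) ^ c)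

/-! ### Projections of single polynomials -/

section Projection

variable {k : Type u} [CommSemiring k] {σ : Type v} {τ : Type w}

/-- *Valiant projection*: `IsProjection g f` means that `g` is a projection of `f`, i.e. `g` is
obtained from `f` by substituting for each variable of `f` a variable of `g` or a constant:
`g = f (a₁, …, aₙ)` with `aᵢ ∈ X(τ) ∪ k` (Valiant 1979; Bürgisser 2000, Def. 2.6(1)). Unrelated
to Mathlib's `LinearMap.IsProj`. [cite: Valiant1979] -/
def IsProjection (g : MvPolynomial τ k) (f : MvPolynomial σ k) : Prop :=
  ∃ a : σ → MvPolynomial τ k, (∀ i, (∃ j, a i = X j) ∨ ∃ c, a i = C c) ∧ g = aeval a f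

end Projection

/-! ### Valiant's Boolean (exponential) sum -/

section BoolSum

variable {k : Type u} [CommSemiring k] {τ : Type v}

/-- Valiant's exponential Boolean sum: for `g` in the variables `τ ⊕ Fin m`, `boolSum g` is
`∑_{e ∈ {0,1}^m} g (X, e)`, a polynomial in the variables `τ` (Valiant 1979; Bürgisser 2000,
Def. 2.5). [cite: Valiant1979] -/
def boolSum {m : ℕ} (g : MvPolynomial (τ ⊕ Fin m) k) : MvPolynomial τ k :=
  ∑ e : Fin m → Bool, aeval (Sum.elim X fun j => if e j then (1 : MvPolynomial τ k) else 0) g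

end BoolSum

/-! ### Families and the classes as predicates -/

section Families

variable {k : Type u} [CommSemiring k] {σ : ℕ → Type v} {τ : ℕ → Type w}

/-- A family `f` is *p-computable* if its circuit complexity `L(fₙ)` is p-bounded
(Bürgisser 2000, Def. 2.2). [cite: Burgisser2000, Def. 2.2] -/
def IsPComputable (f : ∀ n, MvPolynomial (σ n) k) : Prop :=
  IsPBounded fun n => complexity (f n)

/-- *p-projection* of families: `IsPProjection g f` means that `g` is a p-projection of `f`,
i.e. there is a p-bounded `t` with `gₙ` a projection of `f_{t n}` for all `n`
(Bürgisser 2000, Def. 2.6(2); Valiant 1979). [cite: Burgisser2000, Def. 2.6(2] -/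
def IsPProjection (g : ∀ n, MvPolynomial (τ n) k) (f : ∀ n, MvPolynomial (σ n) k) : Prop :=
  ∃ t : ℕ → ℕ, IsPBounded t ∧ ∀ n, IsProjection (g n) (f (t n))

variable [∀ n, Fintype (σ n)]

/-- A family `f = (fₙ)` is a *p-family* if both the number of variables `#(σ n)` and the (total)
degree `deg fₙ` are p-bounded functions of `n` (Bürgisser 2000, Def. 2.3). [cite: Burgisser2000, Def. 2.3] -/
def IsPFamily (f : ∀ n, MvPolynomial (σ n) k) : Prop :=
  IsPBounded (fun n => Fintype.card (σ n)) ∧ IsPBounded fun n => (f n).totalDegree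

/-- Valiant's class `VP` as a predicate: `f` is a p-computable p-family
(Bürgisser 2000, Def. 2.4; Valiant 1979). [cite: Burgisser2000, Def. 2.4] -/
def IsVPFamily (f : ∀ n, MvPolynomial (σ n) k) : Prop :=
  IsPFamily f ∧ IsPComputable f

/-- The class `VQP` as a predicate: `f` is a p-family of quasi-polynomially bounded complexity
(Bürgisser 2000, Def. 2.26). [cite: Burgisser2000, Def. 2.26] -/
def IsVQPFamily (f : ∀ n, MvPolynomial (σ n) k) : Prop :=
  IsPFamily f ∧ IsQPBounded fun n => complexity (f n)

/-- Valiant's class `VNP` as a predicate (*p-definable* families): `f` is a p-family and there is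
a family `g ∈ VP` in the variables `σ n ⊕ Fin (u n)` with `fₙ = ∑_{e ∈ {0,1}^{u n}} gₙ (X, e)`
(Bürgisser 2000, Def. 2.5, literally; Valiant 1979). By Bürgisser 2000, Rem. 2.6 the length
`u n` of the Boolean sum is automatically p-bounded since `g` is a p-family. [cite: Burgisser2000, Def. 2.5  literally] -/
def IsVNPFamily (f : ∀ n, MvPolynomial (σ n) k) : Prop :=
  IsPFamily f ∧ ∃ (u : ℕ → ℕ) (g : ∀ n, MvPolynomial (σ n ⊕ Fin (u n)) k),
    IsVPFamily g ∧ ∀ n, f n = boolSum (g n)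

/-- `f` is `VNP`-*complete*: `f ∈ VNP` and every `g ∈ VNP` is a p-projection of `f`
(Bürgisser 2000, Def. 2.8–2.9; Valiant 1979). The families `g` range over variable types
`Fin (v n)`; their variable bound is part of `IsVNPFamily g`, while the degree bound of `g` would
in any case follow from the projection (`IsProjection.totalDegree_le`). [cite: Burgisser2000, Def. 2.8–2.9] -/
def IsVNPComplete (f : ∀ n, MvPolynomial (σ n) k) : Prop :=
  IsVNPFamily f ∧ ∀ (v : ℕ → ℕ) (g : ∀ n, MvPolynomial (Fin (v n)) k),
    IsVNPFamily g → IsPProjection g f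

/-- `f` is `VP`-*complete* (with respect to p-projections): `f ∈ VP` and every `g ∈ VP` is a
p-projection of `f` (Bürgisser 2000, Def. 2.8 with `VP` in place of `VNP`). [cite: Burgisser2000, Def. 2.8 with  VP  in place of  VNP] -/
def IsVPComplete (f : ∀ n, MvPolynomial (σ n) k) : Prop :=
  IsVPFamily f ∧ ∀ (v : ℕ → ℕ) (g : ∀ n, MvPolynomial (Fin (v n)) k),
    IsVPFamily g → IsPProjection g f

end Families

/-! ### Bundled families and the classes as sets -/

/-- A bundled polynomial family over `k`: a number of variables `nvars n` and a polynomial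
`poly n` in the variables `Fin (nvars n)` for every `n` (carrier for the sets `VP k`, `VNP k`,
`VQP k`; Bürgisser 2000, §2.1). [cite: Burgisser2000, §2.1] -/
structure PolyFamily (k : Type u) [CommSemiring k] : Type u where
  /-- The number of variables of the `n`-th polynomial. -/
  nvars : ℕ → ℕ
  /-- The `n`-th polynomial, in the variables `Fin (nvars n)`. -/
  poly : ∀ n, MvPolynomial (Fin (nvars n)) k

namespace PolyFamily

variable {k : Type u} [CommSemiring k] {σ : ℕ → Type v} [∀ n, Fintype (σ n)]

/-- Bundle a family indexed by finite variable types `σ n`, renaming the variables along the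
(noncanonical) equivalences `Fintype.equivFin (σ n) : σ n ≃ Fin #(σ n)`. Membership in
`VP`/`VNP`/`VQP` does not depend on this choice (`complexity_renameEquiv`;
Bürgisser 2000, Rem. 2.2). [cite: Burgisser2000, Rem. 2.2] -/
def ofFintype (f : ∀ n, MvPolynomial (σ n) k) : PolyFamily k where
  nvars n := Fintype.card (σ n)
  poly n := renameEquiv k (Fintype.equivFin (σ n)) (f n)

end PolyFamily

section Classes

variable (k : Type u) [CommSemiring k]

/-- Valiant's class `VP k` of p-computable p-families over `k`, as a set of bundled families
(Bürgisser 2000, Def. 2.4; Valiant 1979). [cite: Burgisser2000, Def. 2.4] -/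
def VP : Set (PolyFamily k) :=
  {F | IsVPFamily F.poly}

/-- Valiant's class `VNP k` of p-definable families over `k`, as a set of bundled families
(Bürgisser 2000, Def. 2.5; Valiant 1979). [cite: Burgisser2000, Def. 2.5] -/
def VNP : Set (PolyFamily k) :=
  {F | IsVNPFamily F.poly}

/-- The class `VQP k` of p-families of quasi-polynomially bounded complexity over `k`, as a set of
bundled families (Bürgisser 2000, Def. 2.26). [cite: Burgisser2000, Def. 2.26] -/
def VQP : Set (PolyFamily k) :=
  {F | IsVQPFamily F.poly}

end Classes

/-! ### API lemmas -/

namespace IsPBounded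

/-- Constant functions are p-bounded (Bürgisser 2000, Def. 2.1). [cite: Burgisser2000, Def. 2.1] -/
theorem const (c : ℕ) : IsPBounded fun _ => c :=
  ⟨c, fun _ => Nat.le_add_left c _⟩

/-- The identity is p-bounded (Bürgisser 2000, Def. 2.1). [cite: Burgisser2000, Def. 2.1] -/
theorem id : IsPBounded _root_.id :=
  ⟨1, fun n => by simp⟩

/-- p-bounded functions are closed under pointwise sums (Bürgisser 2000, Def. 2.1). [cite: Burgisser2000, Def. 2.1] -/
def add : Prop :=
  ∀ {s t : ℕ → ℕ} (hs : IsPBounded s) (ht : IsPBounded t),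
    IsPBounded fun n => s n + t n

/-- p-bounded functions are closed under pointwise products (Bürgisser 2000, Def. 2.1). [cite: Burgisser2000, Def. 2.1] -/
def mul : Prop :=
  ∀ {s t : ℕ → ℕ} (hs : IsPBounded s) (ht : IsPBounded t),
    IsPBounded fun n => s n * t n

/-- p-bounded functions are closed under fixed powers (Bürgisser 2000, Def. 2.1). [cite: Burgisser2000, Def. 2.1] -/
def pow : Prop :=
  ∀ {t : ℕ → ℕ} (ht : IsPBounded t) (m : ℕ),
    IsPBounded fun n => t n ^ m

/-- p-bounded functions are closed under composition (Bürgisser 2000, Def. 2.1). [cite: Burgisser2000, Def. 2.1] -/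
def comp : Prop :=
  ∀ {s t : ℕ → ℕ} (hs : IsPBounded s) (ht : IsPBounded t),
    IsPBounded fun n => s (t n)

/-- A function pointwise dominated by a p-bounded function is p-bounded
(Bürgisser 2000, Def. 2.1). [cite: Burgisser2000, Def. 2.1] -/
theorem mono {s t : ℕ → ℕ} (ht : IsPBounded t) (h : ∀ n, s n ≤ t n) : IsPBounded s := by
  obtain ⟨c, hc⟩ := ht
  exact ⟨c, fun n => (h n).trans (hc n)⟩

end IsPBounded

/-- `t` is p-bounded iff it is bounded by (the evaluation of) a polynomial with natural
coefficients (Bürgisser 2000, Def. 2.1(1); bridge to the `Polynomial ℕ` convention of the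
Boolean complexity prelude). [cite: Burgisser2000, Def. 2.1(1] -/
def isPBounded_iff_exists_polynomial : Prop :=
  ∀ (t : ℕ → ℕ),
    IsPBounded t ↔ ∃ p : Polynomial ℕ, ∀ n, t n ≤ p.eval n

namespace IsProjection

variable {k : Type u} [CommSemiring k] {σ : Type v} {τ : Type w} {ι : Type*}

/-- Every polynomial is a projection of itself (substitute `X i` for `X i`;
Bürgisser 2000, §2.1). [cite: Burgisser2000, §2.1] -/
theorem refl (f : MvPolynomial σ k) : IsProjection f f :=
  ⟨X, fun i => Or.inl ⟨i, rfl⟩, (aeval_X_left_apply f).symm⟩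

/-- Projections compose: a projection of a projection of `f` is a projection of `f`
(Bürgisser 2000, §2.1, "≤ is transitive"). [cite: Burgisser2000, §2.1  "≤ is transitive"] -/
def trans : Prop :=
  ∀ {h : MvPolynomial ι k} {g : MvPolynomial τ k} {f : MvPolynomial σ k} (hhg : IsProjection h g) (hgf : IsProjection g f),
    IsProjection h f

/-- A projection does not increase the total degree (Bürgisser 2000, §2.1). [cite: Burgisser2000, §2.1] -/
def totalDegree_le : Prop :=
  ∀ {g : MvPolynomial τ k} {f : MvPolynomial σ k} (h : IsProjection g f),
    g.totalDegree ≤ f.totalDegree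

/-- A projection does not increase the circuit complexity: substitute variables and constants
into a circuit for `f`, at no cost (Bürgisser 2000, Rem. 2.7). [cite: Burgisser2000, Rem. 2.7] -/
def complexity_le : Prop :=
  ∀ {g : MvPolynomial τ k} {f : MvPolynomial σ k} (h : IsProjection g f),
    complexity g ≤ complexity f

end IsProjection

section FamilyLemmas

variable {k : Type u} [CommSemiring k] {σ : ℕ → Type v} {τ : ℕ → Type w} {ι : ℕ → Type*}

/-- Every family is a p-projection of itself (with `t = id`; Bürgisser 2000, §2.1). [cite: Burgisser2000, §2.1] -/
theorem IsPProjection.refl (f : ∀ n, MvPolynomial (σ n) k) : IsPProjection f f :=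
  ⟨_root_.id, IsPBounded.id, fun n => IsProjection.refl (f n)⟩

/-- p-projection is transitive (Bürgisser 2000, §2.1). [cite: Burgisser2000, §2.1] -/
def IsPProjection.trans : Prop :=
  ∀ {h : ∀ n, MvPolynomial (ι n) k} {g : ∀ n, MvPolynomial (τ n) k} {f : ∀ n, MvPolynomial (σ n) k} (hhg : IsPProjection h g) (hgf : IsPProjection g f),
    IsPProjection h f

/- interim proof relied on results that are now named facts (D-0014); demoted to a fact by the M5 import, proof preserved:
:= by
  obtain ⟨t₁, ht₁, h₁⟩ := hhg
  obtain ⟨t₂, ht₂, h₂⟩ := hgf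
  exact ⟨fun n => t₂ (t₁ n), ht₂.comp ht₁, fun n => (h₁ n).trans (h₂ (t₁ n))⟩
-/

/-- A p-projection of a p-computable family is p-computable (Bürgisser 2000, Rem. 2.7 and
Prop. 2.7's proof; no p-family hypothesis is needed for the complexity bound). [cite: Burgisser2000, Rem. 2.7 and Prop. 2.7's proof] -/
def IsPComputable.of_isPProjection : Prop :=
  ∀ {g : ∀ n, MvPolynomial (τ n) k} {f : ∀ n, MvPolynomial (σ n) k} (hgf : IsPProjection g f) (hf : IsPComputable f),
    IsPComputable g

/- interim proof relied on results that are now named facts (D-0014); demoted to a fact by the M5 import, proof preserved: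
:= by
  obtain ⟨t, ht, hproj⟩ := hgf
  exact (IsPBounded.comp hf ht).mono fun n => (hproj n).complexity_le
-/

variable [∀ n, Fintype (σ n)] [∀ n, Fintype (τ n)]

/-- `VP` is closed under p-projections among p-families (Bürgisser 2000, §2.1). The hypothesis
`hg : IsPFamily g` is required: a p-projection does not bound the number of variables of `g`. [cite: Burgisser2000, §2.1] -/
def IsVPFamily.of_isPProjection : Prop :=
  ∀ {g : ∀ n, MvPolynomial (τ n) k} {f : ∀ n, MvPolynomial (σ n) k} (hg : IsPFamily g) (hgf : IsPProjection g f) (hf : IsVPFamily f),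
    IsVPFamily g

/- interim proof relied on results that are now named facts (D-0014); demoted to a fact by the M5 import, proof preserved:
:=
  ⟨hg, IsPComputable.of_isPProjection hgf hf.2⟩
-/

/-- `VNP` is closed under p-projections among p-families (Bürgisser 2000, §2.1). The hypothesis
`hg : IsPFamily g` is required: a p-projection does not bound the number of variables of `g`
(e.g. `gₙ = 0` in `2 ^ n` variables is a p-projection of everything but not a p-family). [cite: Burgisser2000, §2.1] -/
def IsVNPFamily.of_isPProjection : Prop :=
  ∀ {g : ∀ n, MvPolynomial (τ n) k} {f : ∀ n, MvPolynomial (σ n) k} (hg : IsPFamily g) (hgf : IsPProjection g f) (hf : IsVNPFamily f),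
    IsVNPFamily g

/-- `VP ⊆ VNP` for predicates: take the empty Boolean sum, `u = 0` (Bürgisser 2000, §2.1). [cite: Burgisser2000, §2.1] -/
def IsVPFamily.isVNPFamily : Prop :=
  ∀ {f : ∀ n, MvPolynomial (σ n) k} (hf : IsVPFamily f),
    IsVNPFamily f

/-- `ofFintype f ∈ VP k` iff `f` is a `VP` family: renaming along an equivalence preserves the
number of variables, the degree and the complexity (`complexity_renameEquiv`;
Bürgisser 2000, Rem. 2.2). [cite: Burgisser2000, Rem. 2.2] -/
def mem_VP_ofFintype_iff : Prop :=
  ∀ (f : ∀ n, MvPolynomial (σ n) k),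
    PolyFamily.ofFintype f ∈ VP k ↔ IsVPFamily f

/-- `ofFintype f ∈ VNP k` iff `f` is a `VNP` family (rename the witness family as well;
Bürgisser 2000, Rem. 2.2). [cite: Burgisser2000, Rem. 2.2] -/
def mem_VNP_ofFintype_iff : Prop :=
  ∀ (f : ∀ n, MvPolynomial (σ n) k),
    PolyFamily.ofFintype f ∈ VNP k ↔ IsVNPFamily f

end FamilyLemmas

section ClassLemmas

variable (k : Type u) [CommSemiring k]

/-- `VP ⊆ VNP` (Bürgisser 2000, §2.1; Valiant 1979). [cite: Burgisser2000, §2.1] -/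
def VP_subset_VNP : Prop :=
  VP k ⊆ VNP k

/- interim proof relied on results that are now named facts (D-0014); demoted to a fact by the M5 import, proof preserved:
:=
  fun _ hF => IsVPFamily.isVNPFamily hF
-/

/-- `VP ⊆ VQP`: a p-bounded function is quasi-polynomially bounded (Bürgisser 2000, §2.5). [cite: Burgisser2000, §2.5] -/
def VP_subset_VQP : Prop :=
  VP k ⊆ VQP k

end ClassLemmas

/-! ### Discharges: arithmetic of p-bounded functions and transitivity of projections

Proofs of the named facts `IsPBounded.add/mul/pow/comp`, `isPBounded_iff_exists_polynomial`,
`IsProjection.trans` and `IsPProjection.trans` (Bürgisser 2000, Def. 2.1(1) and §2.1), through the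
working characterisation `IsPBounded t ↔ ∃ a b, ∀ n, t n ≤ a * (n + 1) ^ b`
(`IsPBounded.iff_exists_le_mul_succ_pow`). -/

namespace IsPBounded

/-- Working form of p-boundedness: `t` is p-bounded iff `t n ≤ a (n + 1) ^ b` for some constants
`a, b` (Bürgisser 2000, Def. 2.1(1): "bounded by a polynomial in `n`"). [cite: Burgisser2000, Def. 2.1(1)] -/
theorem iff_exists_le_mul_succ_pow (t : ℕ → ℕ) :
    IsPBounded t ↔ ∃ a b : ℕ, ∀ n, t n ≤ a * (n + 1) ^ b := by
  constructor
  · rintro ⟨c, hc⟩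
    refine ⟨c + 1, c, fun n => (hc n).trans ?_⟩
    have h1 : n ^ c ≤ (n + 1) ^ c := Nat.pow_le_pow_left (Nat.le_succ n) c
    have h2 : c ≤ c * (n + 1) ^ c := Nat.le_mul_of_pos_right c (Nat.pow_pos n.succ_pos)
    calc n ^ c + c ≤ (n + 1) ^ c + c * (n + 1) ^ c := Nat.add_le_add h1 h2
      _ = (c + 1) * (n + 1) ^ c := by ring
  · rintro ⟨a, b, h⟩
    refine ⟨a * 2 ^ b + a + 2 * b, fun n => (h n).trans ?_⟩
    rcases Nat.lt_or_ge n 2 with hn | hn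
    · have hle : (n + 1) ^ b ≤ 2 ^ b := Nat.pow_le_pow_left (by omega) b
      calc a * (n + 1) ^ b ≤ a * 2 ^ b := Nat.mul_le_mul_left a hle
        _ ≤ a * 2 ^ b + a + 2 * b := by omega
        _ ≤ n ^ (a * 2 ^ b + a + 2 * b) + (a * 2 ^ b + a + 2 * b) := Nat.le_add_left _ _
    · have ha : a ≤ n ^ a := (Nat.lt_pow_self hn).le
      have hb : (n + 1) ^ b ≤ n ^ (2 * b) := by
        calc (n + 1) ^ b ≤ (n * n) ^ b := Nat.pow_le_pow_left (by nlinarith) b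
          _ = n ^ (2 * b) := by rw [← pow_two, ← pow_mul]
      have h1 : 1 ≤ n := by omega
      calc a * (n + 1) ^ b ≤ n ^ a * n ^ (2 * b) := Nat.mul_le_mul ha hb
        _ = n ^ (a + 2 * b) := by rw [pow_add]
        _ ≤ n ^ (a * 2 ^ b + a + 2 * b) := Nat.pow_le_pow_right h1 (by omega)
        _ ≤ _ := Nat.le_add_right _ _

/-- Discharge of `IsPBounded.add` (Bürgisser 2000, Def. 2.1). [cite: Burgisser2000, Def. 2.1(1)] -/
theorem add_holds : IsPBounded.add := by
  intro s t hs ht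
  obtain ⟨a₁, b₁, h₁⟩ := (iff_exists_le_mul_succ_pow s).1 hs
  obtain ⟨a₂, b₂, h₂⟩ := (iff_exists_le_mul_succ_pow t).1 ht
  refine (iff_exists_le_mul_succ_pow _).2 ⟨a₁ + a₂, b₁ + b₂, fun n => ?_⟩
  have e₁ : (n + 1) ^ b₁ ≤ (n + 1) ^ (b₁ + b₂) := Nat.pow_le_pow_right n.succ_pos (by omega)
  have e₂ : (n + 1) ^ b₂ ≤ (n + 1) ^ (b₁ + b₂) := Nat.pow_le_pow_right n.succ_pos (by omega)
  calc s n + t n ≤ a₁ * (n + 1) ^ b₁ + a₂ * (n + 1) ^ b₂ := Nat.add_le_add (h₁ n) (h₂ n)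
    _ ≤ a₁ * (n + 1) ^ (b₁ + b₂) + a₂ * (n + 1) ^ (b₁ + b₂) :=
      Nat.add_le_add (Nat.mul_le_mul_left _ e₁) (Nat.mul_le_mul_left _ e₂)
    _ = (a₁ + a₂) * (n + 1) ^ (b₁ + b₂) := by ring

/-- Discharge of `IsPBounded.mul` (Bürgisser 2000, Def. 2.1). [cite: Burgisser2000, Def. 2.1(1)] -/
theorem mul_holds : IsPBounded.mul := by
  intro s t hs ht
  obtain ⟨a₁, b₁, h₁⟩ := (iff_exists_le_mul_succ_pow s).1 hs
  obtain ⟨a₂, b₂, h₂⟩ := (iff_exists_le_mul_succ_pow t).1 ht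
  refine (iff_exists_le_mul_succ_pow _).2 ⟨a₁ * a₂, b₁ + b₂, fun n => ?_⟩
  calc s n * t n ≤ a₁ * (n + 1) ^ b₁ * (a₂ * (n + 1) ^ b₂) := Nat.mul_le_mul (h₁ n) (h₂ n)
    _ = a₁ * a₂ * (n + 1) ^ (b₁ + b₂) := by ring

/-- Discharge of `IsPBounded.pow` (Bürgisser 2000, Def. 2.1). [cite: Burgisser2000, Def. 2.1(1)] -/
theorem pow_holds : IsPBounded.pow := by
  intro t ht m
  obtain ⟨a, b, h⟩ := (iff_exists_le_mul_succ_pow t).1 ht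
  refine (iff_exists_le_mul_succ_pow _).2 ⟨a ^ m, b * m, fun n => ?_⟩
  calc t n ^ m ≤ (a * (n + 1) ^ b) ^ m := Nat.pow_le_pow_left (h n) m
    _ = a ^ m * (n + 1) ^ (b * m) := by rw [mul_pow, pow_mul]

/-- Discharge of `IsPBounded.comp` (Bürgisser 2000, Def. 2.1). [cite: Burgisser2000, Def. 2.1(1)] -/
theorem comp_holds : IsPBounded.comp := by
  intro s t hs ht
  obtain ⟨a₁, b₁, h₁⟩ := (iff_exists_le_mul_succ_pow s).1 hs
  obtain ⟨a₂, b₂, h₂⟩ := (iff_exists_le_mul_succ_pow t).1 ht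
  refine (iff_exists_le_mul_succ_pow _).2 ⟨a₁ * (a₂ + 1) ^ b₁, b₂ * b₁, fun n => ?_⟩
  have h : t n + 1 ≤ (a₂ + 1) * (n + 1) ^ b₂ := by
    have : 1 ≤ (n + 1) ^ b₂ := Nat.pow_pos n.succ_pos
    calc t n + 1 ≤ a₂ * (n + 1) ^ b₂ + (n + 1) ^ b₂ := Nat.add_le_add (h₂ n) this
      _ = (a₂ + 1) * (n + 1) ^ b₂ := by ring
  calc s (t n) ≤ a₁ * (t n + 1) ^ b₁ := h₁ (t n)
    _ ≤ a₁ * ((a₂ + 1) * (n + 1) ^ b₂) ^ b₁ := Nat.mul_le_mul_left _ (Nat.pow_le_pow_left h b₁)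
    _ = a₁ * (a₂ + 1) ^ b₁ * (n + 1) ^ (b₂ * b₁) := by rw [mul_pow, pow_mul, mul_assoc]

end IsPBounded

/-- Discharge of `isPBounded_iff_exists_polynomial`: `n ↦ n ^ c + c` is the polynomial
`X ^ c + C c`; conversely `p(n) ≤ p(1) (n + 1) ^ deg p` for `p ∈ ℕ[X]`
(Bürgisser 2000, Def. 2.1(1)). [cite: Burgisser2000, Def. 2.1(1)] -/
theorem isPBounded_iff_exists_polynomial_holds : isPBounded_iff_exists_polynomial := by
  intro t
  constructor
  · rintro ⟨c, hc⟩
    exact ⟨Polynomial.X ^ c + Polynomial.C c, fun n => by simpa using hc n⟩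
  · rintro ⟨p, hp⟩
    refine (IsPBounded.iff_exists_le_mul_succ_pow t).2 ⟨p.eval 1, p.natDegree, fun n => (hp n).trans ?_⟩
    rw [Polynomial.eval_eq_sum_range, Polynomial.eval_eq_sum_range, Finset.sum_mul]
    refine Finset.sum_le_sum fun i hi => ?_
    rw [one_pow, mul_one]
    refine Nat.mul_le_mul_left _ ?_
    calc n ^ i ≤ (n + 1) ^ i := Nat.pow_le_pow_left (Nat.le_succ n) i
      _ ≤ (n + 1) ^ p.natDegree :=
        Nat.pow_le_pow_right n.succ_pos (Nat.lt_succ_iff.1 (Finset.mem_range.1 hi))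

namespace IsProjection

variable {k : Type u} [CommSemiring k] {σ : Type v} {τ : Type w} {ι : Type*}

/-- Discharge of `IsProjection.trans`: substitute the substitution (`MvPolynomial.comp_aeval`);
a variable-or-constant substituted into a variable-or-constant is a variable-or-constant
(Bürgisser 2000, §2.1, "≤ is transitive"). [cite: Burgisser2000, §2.1] -/
theorem trans_holds : IsProjection.trans (k := k) (σ := σ) (τ := τ) (ι := ι) := by
  intro h g f hhg hgf
  obtain ⟨b, hb, rfl⟩ := hhg
  obtain ⟨a, ha, rfl⟩ := hgf
  refine ⟨fun i => aeval b (a i), fun i => ?_, ?_⟩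
  · show (∃ j, aeval b (a i) = X j) ∨ ∃ c, aeval b (a i) = C c
    rcases ha i with ⟨j, hj⟩ | ⟨c, hc⟩
    · rw [hj, aeval_X]
      exact hb j
    · rw [hc, algHom_C]
      exact Or.inr ⟨c, rfl⟩
  · rw [← AlgHom.comp_apply, comp_aeval]

end IsProjection

section

variable {k : Type u} [CommSemiring k] {σ : ℕ → Type v} {τ : ℕ → Type w} {ι : ℕ → Type*}

/-- Discharge of `IsPProjection.trans` (the interim proof, fed with `IsPBounded.comp_holds` and
`IsProjection.trans_holds`; Bürgisser 2000, §2.1). [cite: Burgisser2000, §2.1] -/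
theorem IsPProjection.trans_holds : IsPProjection.trans (k := k) (σ := σ) (τ := τ) (ι := ι) := by
  intro h g f hhg hgf
  obtain ⟨t₁, ht₁, h₁⟩ := hhg
  obtain ⟨t₂, ht₂, h₂⟩ := hgf
  exact ⟨fun n => t₂ (t₁ n), IsPBounded.comp_holds ht₂ ht₁,
    fun n => IsProjection.trans_holds (h₁ n) (h₂ (t₁ n))⟩

end

/-! ### Discharges: renaming families and bundling along `Fintype.equivFin` (Bürgisser 2000, Rem. 2.2)

Proofs of the named facts `mem_VP_ofFintype_iff` and `mem_VNP_ofFintype_iff`. Both are instances of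
the invariance of `IsPFamily` / `IsVPFamily` / `IsVNPFamily` under renaming every member of a family
along an equivalence of variable types (`is*Family_renameEquiv_iff`), which rests on
`complexity_renameEquiv_holds` (Bürgisser 2000, Rem. 2.2: the complexity does not depend on the
naming of the variables) and, for `VNP`, on the Boolean sum commuting with renaming
(`boolSum_rename_sumMap`). -/

section OfFintypeDischarges

variable {k : Type u} [CommSemiring k]

section Rename

variable {σ : ℕ → Type v} {τ : ℕ → Type w} [∀ n, Fintype (σ n)] [∀ n, Fintype (τ n)]

/-- Renaming each member of a family along an equivalence of variable types preserves being a
p-family: `Fintype.card_congr` and `MvPolynomial.totalDegree_renameEquiv`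
(Bürgisser 2000, Rem. 2.2). [cite: Burgisser2000, Rem. 2.2] -/
theorem isPFamily_renameEquiv_iff (e : ∀ n, σ n ≃ τ n) (f : ∀ n, MvPolynomial (σ n) k) :
    IsPFamily (fun n => renameEquiv k (e n) (f n)) ↔ IsPFamily f := by
  have h₁ : (fun n => Fintype.card (τ n)) = fun n => Fintype.card (σ n) :=
    funext fun n => (Fintype.card_congr (e n)).symm
  have h₂ : (fun n => (renameEquiv k (e n) (f n)).totalDegree) = fun n => (f n).totalDegree :=
    funext fun n => totalDegree_renameEquiv _ _
  simp only [IsPFamily, h₁, h₂]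

/-- Renaming each member of a family along an equivalence of variable types preserves
`VP`-membership: additionally `complexity_renameEquiv_holds` (Bürgisser 2000, Rem. 2.2: `L(f)`
does not depend on the naming of the variables). [cite: Burgisser2000, Rem. 2.2] -/
theorem isVPFamily_renameEquiv_iff (e : ∀ n, σ n ≃ τ n) (f : ∀ n, MvPolynomial (σ n) k) :
    IsVPFamily (fun n => renameEquiv k (e n) (f n)) ↔ IsVPFamily f := by
  have h₃ : (fun n => complexity (renameEquiv k (e n) (f n))) = fun n => complexity (f n) :=
    funext fun n => complexity_renameEquiv_holds _ _
  simp only [IsVPFamily, isPFamily_renameEquiv_iff, IsPComputable, h₃]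

end Rename

section BoolSumRename

variable {σ : Type v} {τ : Type w}

/-- Valiant's Boolean sum commutes with renaming the free variables: for `e : σ → τ`,
`∑ₑ g(e X, e) = rename e (∑ₑ g(X, e))` (Bürgisser 2000, Def. 2.5 / Rem. 2.2). [cite: Burgisser2000, Rem. 2.2] -/
theorem boolSum_rename_sumMap {m : ℕ} (e : σ → τ) (g : MvPolynomial (σ ⊕ Fin m) k) :
    boolSum (MvPolynomial.rename (Sum.map e id) g) = MvPolynomial.rename e (boolSum g) := by
  simp only [boolSum, map_sum, MvPolynomial.aeval_rename]
  refine Finset.sum_congr rfl fun b _ => ?_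
  rw [← AlgHom.comp_apply, MvPolynomial.comp_aeval]
  congr 2
  funext i
  rcases i with i | j
  · simp
  · simp only [Function.comp_apply, Sum.map_inr, id_eq, Sum.elim_inr]
    split_ifs <;> simp

end BoolSumRename

section RenameVNP

variable {σ : ℕ → Type v} {τ : ℕ → Type w} [∀ n, Fintype (σ n)] [∀ n, Fintype (τ n)]

/-- One direction of `isVNPFamily_renameEquiv_iff`, for an arbitrary pair of variable families:
rename the `VP` witness family along `Equiv.sumCongr (e n) (Equiv.refl _)`
(Bürgisser 2000, Rem. 2.2). [cite: Burgisser2000, Rem. 2.2] -/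
theorem IsVNPFamily.renameEquiv (e : ∀ n, σ n ≃ τ n) {f : ∀ n, MvPolynomial (σ n) k}
    (hf : IsVNPFamily f) : IsVNPFamily (fun n => MvPolynomial.renameEquiv k (e n) (f n)) := by
  obtain ⟨hpf, u, g, hg, hfg⟩ := hf
  refine ⟨(isPFamily_renameEquiv_iff e f).2 hpf, u,
    fun n => MvPolynomial.renameEquiv k ((e n).sumCongr (Equiv.refl (Fin (u n)))) (g n),
    (isVPFamily_renameEquiv_iff _ g).2 hg, fun n => ?_⟩
  simp only [MvPolynomial.renameEquiv_apply, hfg n]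
  rw [← boolSum_rename_sumMap]
  rfl

/-- Renaming each member of a family along an equivalence of variable types preserves
`VNP`-membership: rename the witness family as well, using that the Boolean sum commutes with
renaming (`boolSum_rename_sumMap`; Bürgisser 2000, Rem. 2.2). [cite: Burgisser2000, Rem. 2.2] -/
theorem isVNPFamily_renameEquiv_iff (e : ∀ n, σ n ≃ τ n) (f : ∀ n, MvPolynomial (σ n) k) :
    IsVNPFamily (fun n => renameEquiv k (e n) (f n)) ↔ IsVNPFamily f := by
  refine ⟨fun h => ?_, IsVNPFamily.renameEquiv e⟩
  have h' := h.renameEquiv fun n => (e n).symm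
  simp only [MvPolynomial.renameEquiv_apply, MvPolynomial.rename_rename, Equiv.symm_comp_self,
    MvPolynomial.rename_id_apply] at h'
  exact h'

end RenameVNP

variable {σ : ℕ → Type v} [∀ n, Fintype (σ n)]

/-- Discharge of `mem_VP_ofFintype_iff`: bundling a family along the equivalences
`Fintype.equivFin (σ n)` changes neither the number of variables, nor the degree, nor the
complexity (`isVPFamily_renameEquiv_iff`; Bürgisser 2000, Rem. 2.2). [cite: Burgisser2000, Rem. 2.2] -/
theorem mem_VP_ofFintype_iff_holds : mem_VP_ofFintype_iff (k := k) (σ := σ) :=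
  fun f => isVPFamily_renameEquiv_iff (fun n => Fintype.equivFin (σ n)) f

/-- Discharge of `mem_VNP_ofFintype_iff`: bundling along `Fintype.equivFin (σ n)` preserves
`VNP`-membership (`isVNPFamily_renameEquiv_iff`; Bürgisser 2000, Rem. 2.2). [cite: Burgisser2000, Rem. 2.2] -/
theorem mem_VNP_ofFintype_iff_holds : mem_VNP_ofFintype_iff (k := k) (σ := σ) :=
  fun f => isVNPFamily_renameEquiv_iff (fun n => Fintype.equivFin (σ n)) f

end OfFintypeDischarges

end Literature.Computability.AlgebraicComplexity
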